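import Summits.BirchSwinnertonDyer.Statement

/-!
# BirchSwinnertonDyer / Squeeze — assembly

Route `BirchSwinnertonDyer/Squeeze`, items `stmt-BirchSwinnertonDyer-0493` (r2) and
`stmt-BirchSwinnertonDyer-0142` (same signature): the three inequalities
(UB) `r_MW ≤ r_an`, (LB+1) `r_an ≤ r_MW + 1`, (PAR) `r_MW ≡ r_an (mod 2)` for every elliptic
`E/ℚ` imply the rank part of the Birch and Swinnerton-Dyer conjecture. Pure arithmetic in `ℕ`:
`a ≤ b ≤ a + 1` and `a ≡ b (mod 2)` force `a = b`.
-/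

namespace Literature.BSD

open WeierstrassCurve

/-- Arithmetic core: `a ≤ b ≤ a + 1` and `(Even a ↔ Even b)` give `b = a`. [folklore] -/
theorem eq_of_le_of_le_succ_of_even_iff {a b : ℕ} (h1 : a ≤ b) (h2 : b ≤ a + 1)
    (h3 : Even a ↔ Even b) : b = a := by
  rcases Nat.even_or_odd a with ⟨x, hx⟩ | ⟨x, hx⟩ <;>
    rcases Nat.even_or_odd b with ⟨y, hy⟩ | ⟨y, hy⟩
  · omega
  · exfalso
    have := h3.1 ⟨x, hx⟩
    rw [hy] at this
    exact Nat.not_even_two_mul_add_one _ this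
  · exfalso
    have := h3.2 ⟨y, hy⟩
    rw [hx] at this
    exact Nat.not_even_two_mul_add_one _ this
  · omega

/-- Settles `stmt-BirchSwinnertonDyer-0493` / `stmt-BirchSwinnertonDyer-0142` (assembly of route
Squeeze): (UB) ∧ (LB+1) ∧ (PAR) for all elliptic `E/ℚ` imply `BirchSwinnertonDyer`
(`r_an = r_MW`). [folklore] -/
theorem squeeze_assembly :
    ((∀ (W : WeierstrassCurve ℚ) [W.IsElliptic], W.mordellWeilRank ≤ W.analyticRank) ∧
      (∀ (W : WeierstrassCurve ℚ) [W.IsElliptic], W.analyticRank ≤ W.mordellWeilRank + 1) ∧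
      (∀ (W : WeierstrassCurve ℚ) [W.IsElliptic], Even W.mordellWeilRank ↔ Even W.analyticRank)) →
    BirchSwinnertonDyer := by
  rintro ⟨hUB, hLB, hPAR⟩ W hW
  exact eq_of_le_of_le_succ_of_even_iff (@hUB W hW) (@hLB W hW) (@hPAR W hW)

end Literature.BSD
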